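import Summits.ABC.IUTFork.Cor312GenuineKTamePlaces
import HarnessLib

/-!
# Rational points `P = ratPoint q` (`F_tpd = ℚ`): every place over `p ∉ {2, 3, 5, l}` of the `l`-division field of a genuine
# Θ-volume datum is absolutely tame, `e ≤ 46080·l`, `d = (e−1)/e < 1`, `d + a + b ≤ 2 + log(46080·l)/log p` — hypothesis-free
# (proof-only; abc-iut cell, D-0079 R-W lane U, seat abc-iut-w5-d157 gen 7; sequel of `Cor312GenuineKTamePlaces`)

PROOF-ONLY (0 definitions, 0 `Prop` facts). TAKES NO SIDE on [IUTchIII] Cor. 3.12 or on any author. The base hypothesis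
`p ∤ e(v₀|p)` of `Cor312GenuineKTamePlaces` is automatic over `F_tpd = ℚ` (`e(v₀|p) = 1`), so for EVERY genuine datum
`T : Cor22.ThetaVolumeDatumAt (ratPoint q) l` (`λ = q ∈ U_X`), EVERY prime `p ∉ {2, 3, 5, l}` and EVERY place `w | p` of `K = T.K`
(resp. every point `x₀` of the fibre over `p` of the index of `Cor312Prov.pilotDataOfK T.D T.K`, `K_w = kOf … p x₀`):
`p ∤ e(w|p)`, `e(w|p) ≤ 46080·l`, `d(K_w) = (e−1)/e`, `d(K_w) < 1`, `d + a + b ≤ 2 + log(46080·l)/log p` (the fibre form of the size bound,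
`GenuineK.absRamificationIdx_kOf_le_ratPoint`, is abc-iut-w5-d163's, `Conditional/AbcOfSGenuineKChosenDepthHexSharpEngine.lean` — cited, not restated;
`λ ∈ U_X` is read off the datum by `ThetaVolumeDatumAt.inU`, so no side hypothesis remains). These are the WINDOW-TABLE
(plan/rescue/R-W) columns `e_w`, `d_w`, «absolutely tame» as KERNEL facts for every packet over such `p` of every rational-point datum —
e.g. the HEX family `λ_k = 1/2 + 2/7^k` at `p = 7`, all local types and all `l ≥ 11` (the exact local type `e(v|7) ∣ 30` of the
table's ASSUMPTION A1 is NOT claimed). HONEST FRAMING: bookkeeping over OUR typed objects; nothing here bears on the printed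
inequality of [IUTchIII] Cor. 3.12, on `Cor22.Cor312AtDatum`, or on S_H; typed ≠ proved; instantiated ≠ endorsed.
[cite: Mochizuki2012, IUTchIV Thm. 1.10 Steps (ii)–(iii) p. 24–26; Prop. 1.1/1.2 p. 9–10] [cite: NeukirchANT1999, Ch. I §8 Prop. (8.2); Ch. II Prop. (6.8)]
[cite: SerreLocalFields1979, Ch. III §6 Prop. 13] [claim: Mochizuki2012, status: disputed] for every IUT quotation.
-/

noncomputable section

open NumberField IsDedekindDomain

namespace Summit.ABC.IUTFork.Conditional

open Thm311 Thm311.Real Cor312 Cor312Prov Literature.IUT.LogVolume Literature.IUT.HodgeTheaters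
  Literature.IUT.LogThetaLattice Literature.NumberTheory.NumberFields Literature.NumberTheory.DiophantineGeometry.GenEll
  Literature.NumberTheory.EllipticCurves Literature.NumberTheory.GaloisRepresentations

variable {l : ℕ}

/-! ## §3. Rational points `P = ratPoint q` (`F_tpd = ℚ`): the base hypothesis is automatic -/

/-- `e(v₀|p) = 1` for every finite place `v₀` of `F_tpd = ℚ` (`e(v₀|p) ≤ [ℚ : ℚ] = 1` and `e ≠ 0`). [cite: NeukirchANT1999, Ch. I §8 Prop. (8.2)] -/
theorem GenuineK.ramIdx_ratPoint_eq_one (q : ℚ) (v₀ : HeightOneSpectrum (𝓞 (ratPoint q).F)) :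
    ramIdx (ratPoint q).F v₀ = 1 := by
  have h1 := ramificationIdx_int_le_finrank_rat (F₀ := (ratPoint q).F) v₀
  have hdeg : Module.finrank ℚ (ratPoint q).F = 1 := degree_ratPoint q
  rw [hdeg, ← ramIdx_eq] at h1
  have h2 : ramIdx (ratPoint q).F v₀ ≠ 0 := ramIdx_ne_zero (ratPoint q).F v₀
  omega

variable {q : ℚ} (T₁ : Cor22.ThetaVolumeDatumAt (ratPoint q) l)

/-- **Rational point: `p ∤ e(w|p)` at EVERY place `w | p` of `K`, `p ∉ {2, 3, 5, l}`** — every such place of the `l`-division field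
of a genuine Θ-volume datum over a rational point is ABSOLUTELY TAMELY ramified.
[cite: Mochizuki2012, IUTchIV Thm. 1.10 Steps (ii)–(iii) p. 24–26] [cite: NeukirchANT1999, Ch. II Prop. (6.8)] -/
theorem GenuineK.not_dvd_ramificationIdx_int_ratPoint (pp : Nat.Primes)
    (hp2 : (pp : ℕ) ≠ 2) (hp3 : (pp : ℕ) ≠ 3) (hp5 : (pp : ℕ) ≠ 5) (hpl : (pp : ℕ) ≠ l)
    (w : letI := T₁.instFieldK; letI := T₁.instNumberFieldK; HeightOneSpectrum (𝓞 T₁.K))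
    (hpw : letI := T₁.instFieldK; letI := T₁.instNumberFieldK; ((pp : ℕ) : 𝓞 T₁.K) ∈ w.asIdeal) :
    letI := T₁.instFieldK; letI := T₁.instNumberFieldK
    ¬ (pp : ℕ) ∣ w.asIdeal.ramificationIdx ℤ :=
  GenuineK.not_dvd_ramificationIdx_int_of_place T₁ T₁.inU pp hp2 hp3 hp5 hpl w hpw
    (by rw [GenuineK.ramIdx_ratPoint_eq_one, Nat.dvd_one]; exact pp.2.ne_one)

/-- **Rational point: `e(w|p) ≤ 46080·l` at EVERY place `w | p` of `K`, `p ∉ {2, l}`.**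
[cite: Mochizuki2012, IUTchIV Thm. 1.10 Steps (ii)–(iii) (R2) p. 24–25] -/
theorem GenuineK.ramificationIdx_int_le_ratPoint (pp : Nat.Primes) (hp2 : (pp : ℕ) ≠ 2)
    (hpl : (pp : ℕ) ≠ l)
    (w : letI := T₁.instFieldK; letI := T₁.instNumberFieldK; HeightOneSpectrum (𝓞 T₁.K))
    (hpw : letI := T₁.instFieldK; letI := T₁.instNumberFieldK; ((pp : ℕ) : 𝓞 T₁.K) ∈ w.asIdeal) :
    letI := T₁.instFieldK; letI := T₁.instNumberFieldK
    w.asIdeal.ramificationIdx ℤ ≤ 46080 * l := by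
  have h := GenuineK.ramificationIdx_int_le_of_place T₁ T₁.inU pp hp2 hpl w hpw
  rw [GenuineK.ramIdx_ratPoint_eq_one, one_mul] at h
  exact h

/-- **Rational point, fibre form: `p ∤ e(K_w/ℚ_p)` at EVERY `x₀ | p`**, `p ∉ {2, 3, 5, l}`.
[cite: Mochizuki2012, IUTchIV Thm. 1.10 Steps (ii)–(iii) p. 24–26] [cite: SerreLocalFields1979, Ch. III §6 Prop. 13] -/
theorem GenuineK.not_dvd_absRamificationIdx_kOf_ratPoint (pp : Nat.Primes)
    (hp2 : (pp : ℕ) ≠ 2) (hp3 : (pp : ℕ) ≠ 3) (hp5 : (pp : ℕ) ≠ 5) (hpl : (pp : ℕ) ≠ l)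
    (x₀ : letI := T₁.instFieldF; letI := T₁.instNumberFieldF; letI := T₁.instAlgebraF; letI := T₁.instFieldK
      letI := T₁.instNumberFieldK; letI := T₁.instAlgebraK; letI := T₁.instFieldFbar; letI := T₁.instAlgebraFbar
      letI := T₁.instAlgebraKFbar; letI := T₁.instIsElliptic
      (thetaIndex (pilotDataOfK T₁.D T₁.K)).Fibre (.inr pp)) :
    letI := T₁.instFieldF; letI := T₁.instNumberFieldF; letI := T₁.instAlgebraF; letI := T₁.instFieldK
    letI := T₁.instNumberFieldK; letI := T₁.instAlgebraK; letI := T₁.instFieldFbar; letI := T₁.instAlgebraFbar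
    letI := T₁.instAlgebraKFbar; letI := T₁.instIsElliptic
    haveI : Fact (pp : ℕ).Prime := ⟨pp.2⟩
    ¬ (pp : ℕ) ∣ absRamificationIdx (pp : ℕ) (kOf (pilotDataOfK T₁.D T₁.K) pp.1 x₀) :=
  GenuineK.not_dvd_absRamificationIdx_kOf T₁ T₁.inU pp hp2 hp3 hp5 hpl x₀
    (by rw [GenuineK.ramIdx_ratPoint_eq_one, Nat.dvd_one]; exact pp.2.ne_one)

/-- **Rational point, fibre form: `d(K_w) = (e − 1)/e` EXACTLY at EVERY `x₀ | p`**, `p ∉ {2, 3, 5, l}` — the WINDOW-TABLE column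
`d_w` of EVERY packet of a rational-point datum over such `p` (all local types of the HEX family at `p = 7`, `l ≥ 11`).
[cite: SerreLocalFields1979, Ch. III §6 Prop. 13] [cite: Mochizuki2012, IUTchIV Prop. 1.1 p. 9] -/
theorem GenuineK.differentOrd_kOf_eq_ratPoint (pp : Nat.Primes)
    (hp2 : (pp : ℕ) ≠ 2) (hp3 : (pp : ℕ) ≠ 3) (hp5 : (pp : ℕ) ≠ 5) (hpl : (pp : ℕ) ≠ l)
    (x₀ : letI := T₁.instFieldF; letI := T₁.instNumberFieldF; letI := T₁.instAlgebraF; letI := T₁.instFieldK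
      letI := T₁.instNumberFieldK; letI := T₁.instAlgebraK; letI := T₁.instFieldFbar; letI := T₁.instAlgebraFbar
      letI := T₁.instAlgebraKFbar; letI := T₁.instIsElliptic
      (thetaIndex (pilotDataOfK T₁.D T₁.K)).Fibre (.inr pp)) :
    letI := T₁.instFieldF; letI := T₁.instNumberFieldF; letI := T₁.instAlgebraF; letI := T₁.instFieldK
    letI := T₁.instNumberFieldK; letI := T₁.instAlgebraK; letI := T₁.instFieldFbar; letI := T₁.instAlgebraFbar
    letI := T₁.instAlgebraKFbar; letI := T₁.instIsElliptic
    haveI : Fact (pp : ℕ).Prime := ⟨pp.2⟩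
    differentOrd (pp : ℕ) (kOf (pilotDataOfK T₁.D T₁.K) pp.1 x₀) =
      ((absRamificationIdx (pp : ℕ) (kOf (pilotDataOfK T₁.D T₁.K) pp.1 x₀) : ℝ) - 1) /
        absRamificationIdx (pp : ℕ) (kOf (pilotDataOfK T₁.D T₁.K) pp.1 x₀) :=
  GenuineK.differentOrd_kOf_eq T₁ T₁.inU pp hp2 hp3 hp5 hpl x₀
    (by rw [GenuineK.ramIdx_ratPoint_eq_one, Nat.dvd_one]; exact pp.2.ne_one)

/-- **Rational point, fibre form: `d(K_w) < 1` at EVERY `x₀ | p`**, `p ∉ {2, 3, 5, l}`.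
[cite: SerreLocalFields1979, Ch. III §6 Prop. 13] [cite: Mochizuki2012, IUTchIV Prop. 1.1 p. 9] -/
theorem GenuineK.differentOrd_kOf_lt_one_ratPoint (pp : Nat.Primes)
    (hp2 : (pp : ℕ) ≠ 2) (hp3 : (pp : ℕ) ≠ 3) (hp5 : (pp : ℕ) ≠ 5) (hpl : (pp : ℕ) ≠ l)
    (x₀ : letI := T₁.instFieldF; letI := T₁.instNumberFieldF; letI := T₁.instAlgebraF; letI := T₁.instFieldK
      letI := T₁.instNumberFieldK; letI := T₁.instAlgebraK; letI := T₁.instFieldFbar; letI := T₁.instAlgebraFbar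
      letI := T₁.instAlgebraKFbar; letI := T₁.instIsElliptic
      (thetaIndex (pilotDataOfK T₁.D T₁.K)).Fibre (.inr pp)) :
    letI := T₁.instFieldF; letI := T₁.instNumberFieldF; letI := T₁.instAlgebraF; letI := T₁.instFieldK
    letI := T₁.instNumberFieldK; letI := T₁.instAlgebraK; letI := T₁.instFieldFbar; letI := T₁.instAlgebraFbar
    letI := T₁.instAlgebraKFbar; letI := T₁.instIsElliptic
    haveI : Fact (pp : ℕ).Prime := ⟨pp.2⟩
    differentOrd (pp : ℕ) (kOf (pilotDataOfK T₁.D T₁.K) pp.1 x₀) < 1 := by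
  letI := T₁.instFieldF; letI := T₁.instNumberFieldF; letI := T₁.instAlgebraF; letI := T₁.instFieldK
  letI := T₁.instNumberFieldK; letI := T₁.instAlgebraK; letI := T₁.instFieldFbar; letI := T₁.instAlgebraFbar
  letI := T₁.instAlgebraKFbar; letI := T₁.instIsElliptic
  haveI : Fact (pp : ℕ).Prime := ⟨pp.2⟩
  rw [GenuineK.differentOrd_kOf_eq_ratPoint T₁ pp hp2 hp3 hp5 hpl x₀]
  have he : (0 : ℝ) < absRamificationIdx (pp : ℕ) (kOf (pilotDataOfK T₁.D T₁.K) pp.1 x₀) := by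
    exact_mod_cast absRamificationIdx_pos (pp : ℕ) (kOf (pilotDataOfK T₁.D T₁.K) pp.1 x₀)
  rw [div_lt_one he]
  linarith

/-- **Rational point, fibre form: `d + a + b ≤ 2 + log(46080·l)/log p` at EVERY `x₀ | p`**, `p ∉ {2, 3, 5, l}` — the per-factor
[IUTchIV] Prop. 1.1/1.2 exponent bound at every place over `p` (HEX family at `p = 7`: `≤ 2 + log₇(46080·l)` at every `x₀ | 7`
and every `l ≥ 11`, versus `2 + log₇(46080·l(l−1)²(l+1))` at one place in the ∃-form).
[cite: Mochizuki2012, IUTchIV Prop. 1.2 p. 10, Thm. 1.10 Steps (ii)–(iii) p. 24–26] [claim: Mochizuki2012, status: disputed] -/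
theorem GenuineK.depthConstants_kOf_le_ratPoint (pp : Nat.Primes)
    (hp2 : (pp : ℕ) ≠ 2) (hp3 : (pp : ℕ) ≠ 3) (hp5 : (pp : ℕ) ≠ 5) (hpl : (pp : ℕ) ≠ l)
    (x₀ : letI := T₁.instFieldF; letI := T₁.instNumberFieldF; letI := T₁.instAlgebraF; letI := T₁.instFieldK
      letI := T₁.instNumberFieldK; letI := T₁.instAlgebraK; letI := T₁.instFieldFbar; letI := T₁.instAlgebraFbar
      letI := T₁.instAlgebraKFbar; letI := T₁.instIsElliptic
      (thetaIndex (pilotDataOfK T₁.D T₁.K)).Fibre (.inr pp)) :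
    letI := T₁.instFieldF; letI := T₁.instNumberFieldF; letI := T₁.instAlgebraF; letI := T₁.instFieldK
    letI := T₁.instNumberFieldK; letI := T₁.instAlgebraK; letI := T₁.instFieldFbar; letI := T₁.instAlgebraFbar
    letI := T₁.instAlgebraKFbar; letI := T₁.instIsElliptic
    haveI : Fact (pp : ℕ).Prime := ⟨pp.2⟩
    differentOrd (pp : ℕ) (kOf (pilotDataOfK T₁.D T₁.K) pp.1 x₀)
        + logRadiusA (pp : ℕ) (absRamificationIdx (pp : ℕ) (kOf (pilotDataOfK T₁.D T₁.K) pp.1 x₀))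
        + logRadiusB (pp : ℕ) (absRamificationIdx (pp : ℕ) (kOf (pilotDataOfK T₁.D T₁.K) pp.1 x₀)) ≤
      2 + Real.log ((46080 * l : ℕ) : ℝ) / Real.log (pp : ℕ) := by
  have h := GenuineK.depthConstants_kOf_le T₁ T₁.inU pp hp2 hp3 hp5 hpl x₀
    (by rw [GenuineK.ramIdx_ratPoint_eq_one, Nat.dvd_one]; exact pp.2.ne_one)
  rw [GenuineK.ramIdx_ratPoint_eq_one, one_mul] at h
  exact h

/-! ## §4 (v2, appended; same seat). Low-degree base points `[F_tpd : ℚ] < p`: the base hypothesis `p ∤ e(v₀|p)` is automatic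

For a point `P` of the `λ`-line over a number field `F_tpd = P.F` with `[F_tpd : ℚ] < p` (e.g. the degree-`2` Broberg data over `ℚ(√7)` at
any `p ≥ 3`, or every rational point), `e(v₀|p) ≤ [F_tpd : ℚ] < p` forces `p ∤ e(v₀|p)` at EVERY place `v₀ | p` of `F_tpd`, so the
∀-place theorems of `Cor312GenuineKTamePlaces` apply with no base hypothesis. [cite: NeukirchANT1999, Ch. I §8 Prop. (8.2)]
-/

/-- **`p ∤ e(v₀|p)` at every finite place `v₀` of a number field `F_tpd` with `[F_tpd : ℚ] < p`** (`1 ≤ e(v₀|p) ≤ [F_tpd : ℚ] < p`).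
[cite: NeukirchANT1999, Ch. I §8 Prop. (8.2)] -/
theorem GenuineK.not_dvd_ramIdx_of_degree_lt {P : NFPoint} (pp : Nat.Primes) (hdeg : P.degree < (pp : ℕ))
    (v₀ : HeightOneSpectrum (𝓞 P.F)) : ¬ (pp : ℕ) ∣ ramIdx P.F v₀ := by
  have h1 := ramificationIdx_int_le_finrank_rat (F₀ := P.F) v₀
  rw [← ramIdx_eq] at h1
  have h2 : ramIdx P.F v₀ ≠ 0 := ramIdx_ne_zero P.F v₀
  have h3 : ramIdx P.F v₀ < (pp : ℕ) := lt_of_le_of_lt h1 hdeg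
  intro h
  exact absurd (Nat.le_of_dvd (Nat.pos_of_ne_zero h2) h) (not_le.mpr h3)

variable {P : NFPoint} (T : Cor22.ThetaVolumeDatumAt P l)

/-- **Low-degree base, place form: `p ∤ e(w|p)` at EVERY place `w | p` of `K`**, `p ∉ {2, 3, 5, l}`, `[F_tpd : ℚ] < p`.
[cite: Mochizuki2012, IUTchIV Thm. 1.10 Steps (ii)–(iii) p. 24–26] [cite: NeukirchANT1999, Ch. II Prop. (6.8)] -/
theorem GenuineK.not_dvd_ramificationIdx_int_of_degree_lt (pp : Nat.Primes) (hdeg : P.degree < (pp : ℕ))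
    (hp2 : (pp : ℕ) ≠ 2) (hp3 : (pp : ℕ) ≠ 3) (hp5 : (pp : ℕ) ≠ 5) (hpl : (pp : ℕ) ≠ l)
    (w : letI := T.instFieldK; letI := T.instNumberFieldK; HeightOneSpectrum (𝓞 T.K))
    (hpw : letI := T.instFieldK; letI := T.instNumberFieldK; ((pp : ℕ) : 𝓞 T.K) ∈ w.asIdeal) :
    letI := T.instFieldK; letI := T.instNumberFieldK
    ¬ (pp : ℕ) ∣ w.asIdeal.ramificationIdx ℤ :=
  GenuineK.not_dvd_ramificationIdx_int_of_place T T.inU pp hp2 hp3 hp5 hpl w hpw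
    (GenuineK.not_dvd_ramIdx_of_degree_lt pp hdeg _)

/-- **Low-degree base, fibre form: `p ∤ e(K_w/ℚ_p)` at EVERY `x₀ | p`**, `p ∉ {2, 3, 5, l}`, `[F_tpd : ℚ] < p`.
[cite: Mochizuki2012, IUTchIV Thm. 1.10 Steps (ii)–(iii) p. 24–26] [cite: SerreLocalFields1979, Ch. III §6 Prop. 13] -/
theorem GenuineK.not_dvd_absRamificationIdx_kOf_of_degree_lt (pp : Nat.Primes) (hdeg : P.degree < (pp : ℕ))
    (hp2 : (pp : ℕ) ≠ 2) (hp3 : (pp : ℕ) ≠ 3) (hp5 : (pp : ℕ) ≠ 5) (hpl : (pp : ℕ) ≠ l)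
    (x₀ : letI := T.instFieldF; letI := T.instNumberFieldF; letI := T.instAlgebraF; letI := T.instFieldK
      letI := T.instNumberFieldK; letI := T.instAlgebraK; letI := T.instFieldFbar; letI := T.instAlgebraFbar
      letI := T.instAlgebraKFbar; letI := T.instIsElliptic
      (thetaIndex (pilotDataOfK T.D T.K)).Fibre (.inr pp)) :
    letI := T.instFieldF; letI := T.instNumberFieldF; letI := T.instAlgebraF; letI := T.instFieldK
    letI := T.instNumberFieldK; letI := T.instAlgebraK; letI := T.instFieldFbar; letI := T.instAlgebraFbar
    letI := T.instAlgebraKFbar; letI := T.instIsElliptic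
    haveI : Fact (pp : ℕ).Prime := ⟨pp.2⟩
    ¬ (pp : ℕ) ∣ absRamificationIdx (pp : ℕ) (kOf (pilotDataOfK T.D T.K) pp.1 x₀) :=
  GenuineK.not_dvd_absRamificationIdx_kOf T T.inU pp hp2 hp3 hp5 hpl x₀
    (GenuineK.not_dvd_ramIdx_of_degree_lt pp hdeg _)

/-- **Low-degree base, fibre form: `d(K_w) = (e − 1)/e` EXACTLY at EVERY `x₀ | p`**, `p ∉ {2, 3, 5, l}`, `[F_tpd : ℚ] < p` — the
WINDOW-TABLE column `d_w` for every packet over such `p` of a datum over a base of degree `< p` (degree-`2` data: every `p ≥ 7`, `p ≠ l`).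
[cite: SerreLocalFields1979, Ch. III §6 Prop. 13] [cite: Mochizuki2012, IUTchIV Prop. 1.1 p. 9] -/
theorem GenuineK.differentOrd_kOf_eq_of_degree_lt (pp : Nat.Primes) (hdeg : P.degree < (pp : ℕ))
    (hp2 : (pp : ℕ) ≠ 2) (hp3 : (pp : ℕ) ≠ 3) (hp5 : (pp : ℕ) ≠ 5) (hpl : (pp : ℕ) ≠ l)
    (x₀ : letI := T.instFieldF; letI := T.instNumberFieldF; letI := T.instAlgebraF; letI := T.instFieldK
      letI := T.instNumberFieldK; letI := T.instAlgebraK; letI := T.instFieldFbar; letI := T.instAlgebraFbar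
      letI := T.instAlgebraKFbar; letI := T.instIsElliptic
      (thetaIndex (pilotDataOfK T.D T.K)).Fibre (.inr pp)) :
    letI := T.instFieldF; letI := T.instNumberFieldF; letI := T.instAlgebraF; letI := T.instFieldK
    letI := T.instNumberFieldK; letI := T.instAlgebraK; letI := T.instFieldFbar; letI := T.instAlgebraFbar
    letI := T.instAlgebraKFbar; letI := T.instIsElliptic
    haveI : Fact (pp : ℕ).Prime := ⟨pp.2⟩
    differentOrd (pp : ℕ) (kOf (pilotDataOfK T.D T.K) pp.1 x₀) =
      ((absRamificationIdx (pp : ℕ) (kOf (pilotDataOfK T.D T.K) pp.1 x₀) : ℝ) - 1) /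
        absRamificationIdx (pp : ℕ) (kOf (pilotDataOfK T.D T.K) pp.1 x₀) :=
  GenuineK.differentOrd_kOf_eq T T.inU pp hp2 hp3 hp5 hpl x₀
    (GenuineK.not_dvd_ramIdx_of_degree_lt pp hdeg _)

/-- **Low-degree base, fibre form: `d + a + b ≤ 2 + log([F_tpd : ℚ]·46080·l)/log p` at EVERY `x₀ | p`**, `p ∉ {2, 3, 5, l}`,
`[F_tpd : ℚ] < p` (`e(v₀|p) ≤ [F_tpd : ℚ]` in the size bound of `GenuineK.depthConstants_kOf_le`).
[cite: Mochizuki2012, IUTchIV Prop. 1.2 p. 10, Thm. 1.10 Steps (ii)–(iii) p. 24–26] [claim: Mochizuki2012, status: disputed] -/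
theorem GenuineK.depthConstants_kOf_le_of_degree_lt (pp : Nat.Primes) (hdeg : P.degree < (pp : ℕ))
    (hp2 : (pp : ℕ) ≠ 2) (hp3 : (pp : ℕ) ≠ 3) (hp5 : (pp : ℕ) ≠ 5) (hpl : (pp : ℕ) ≠ l)
    (x₀ : letI := T.instFieldF; letI := T.instNumberFieldF; letI := T.instAlgebraF; letI := T.instFieldK
      letI := T.instNumberFieldK; letI := T.instAlgebraK; letI := T.instFieldFbar; letI := T.instAlgebraFbar
      letI := T.instAlgebraKFbar; letI := T.instIsElliptic
      (thetaIndex (pilotDataOfK T.D T.K)).Fibre (.inr pp)) :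
    letI := T.instFieldF; letI := T.instNumberFieldF; letI := T.instAlgebraF; letI := T.instFieldK
    letI := T.instNumberFieldK; letI := T.instAlgebraK; letI := T.instFieldFbar; letI := T.instAlgebraFbar
    letI := T.instAlgebraKFbar; letI := T.instIsElliptic
    haveI : Fact (pp : ℕ).Prime := ⟨pp.2⟩
    differentOrd (pp : ℕ) (kOf (pilotDataOfK T.D T.K) pp.1 x₀)
        + logRadiusA (pp : ℕ) (absRamificationIdx (pp : ℕ) (kOf (pilotDataOfK T.D T.K) pp.1 x₀))
        + logRadiusB (pp : ℕ) (absRamificationIdx (pp : ℕ) (kOf (pilotDataOfK T.D T.K) pp.1 x₀)) ≤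
      2 + Real.log ((P.degree * 46080 * l : ℕ) : ℝ) / Real.log (pp : ℕ) := by
  letI := T.instFieldF; letI := T.instNumberFieldF; letI := T.instAlgebraF; letI := T.instFieldK
  letI := T.instNumberFieldK; letI := T.instAlgebraK; letI := T.instFieldFbar; letI := T.instAlgebraFbar
  letI := T.instAlgebraKFbar; letI := T.instIsElliptic
  haveI : Fact (pp : ℕ).Prime := ⟨pp.2⟩
  have h := GenuineK.depthConstants_kOf_le T T.inU pp hp2 hp3 hp5 hpl x₀ (GenuineK.not_dvd_ramIdx_of_degree_lt pp hdeg _)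
  refine h.trans ?_
  set v₀ := finBelow P.F T.F (finBelow T.F T.K (placeOf (pilotDataOfK T.D T.K) pp.1 x₀)) with hv₀
  have hram : ramIdx P.F v₀ ≤ P.degree := by
    have h1 := ramificationIdx_int_le_finrank_rat (F₀ := P.F) v₀
    rw [← ramIdx_eq] at h1
    exact h1
  have hpos : 0 < ramIdx P.F v₀ * 46080 * l := by
    have h0 : 0 < ramIdx P.F v₀ := Nat.pos_of_ne_zero (ramIdx_ne_zero P.F v₀)
    have hl : 0 < l := T.D.l_prime.pos
    positivity
  have hle : ((ramIdx P.F v₀ * 46080 * l : ℕ) : ℝ) ≤ ((P.degree * 46080 * l : ℕ) : ℝ) := by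
    exact_mod_cast Nat.mul_le_mul_right l (Nat.mul_le_mul_right 46080 hram)
  have hlogp : 0 < Real.log (pp : ℕ) := Real.log_pos (by exact_mod_cast pp.2.one_lt)
  have hlog := Real.log_le_log (by exact_mod_cast hpos) hle
  have := div_le_div_of_nonneg_right hlog hlogp.le
  linarith

end Summit.ABC.IUTFork.Conditional

end
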